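import Literature.Computability.Complexity.GateElimination

/-!
# Gate elimination, II: fair semicircuits, rdq-sources, the measure `μ`, and Li–Yang's Thm. 4.1
# reduced to its one-step claim

This file vendors the *state space* of the gate-elimination induction of Li–Yang (STOC 2022; full
version ECCC TR21-023), §2.3–§2.5 and §3.1–§3.2, and reduces Theorem 4.1 — the named fact
`LiYang2022_measure_ge` of `GateElimination.lean`, the only unproved input to `Literature.Computability.Complexity.li_yang`
— to the ONE-STEP CLAIM of its proof (ECCC TR21-023, p. 19), vendored here as the named fact
`LiYang2022_step`; the induction on substitutions and the specialisation to ordinary circuits are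
proved.

* `Semicircuit n` — a *fair-able semicircuit* on the variables `x_0, …, x_{n-1}` (Li–Yang Def. 2.5):
  `m` binary gates, gate `j` labelled by a binary Boolean function `op j` (any of the 16; §2.1:
  trivial, degenerate, ⊕-type, ∧-type) and wired (`arg j 0`, `arg j 1`) to nodes, a `Node` being a
  constant (§2.4), a variable or a gate; a distinguished set `xorPart` of ⊕-type gates closed
  under predecessors (the *cyclic xor-circuit* `C₁`, in which cycles are allowed) such that the
  remaining gates form an acyclic circuit `C₂` fed by variables, `C₁` and earlier gates of `C₂`
  (`acyclic`: a rank function strictly increasing along `C₂ → C₂` wires); one output node.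
  `Semicircuit.Fair` (§2.5): for every input the gate equations have exactly one solution (a
  hypothesis on `C`, not a claim: `Semicircuit.exists_not_fair`).
* `Semicircuit.fanout`, `Semicircuit.Troubled` (Def. 3.1), `Semicircuit.troubledCount`,
  `Semicircuit.Adjacent` (Def. 3.1), `Semicircuit.IsPacking` (Def. 3.2–3.3: a set of pairwise
  disjoint pairs of adjacent troubled gates), `Semicircuit.potential` (Def. 3.5:
  `Φ(C, 𝒫) = #troubled - |𝒫|`).
* `RdqSource n` — a *read-once depth-two quadratic source* (Def. 2.2): every variable is free, or
  linear with an affine equation `x_j = ⊕_{i ∈ S} x_i ⊕ c` over free and quadratic variables, or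
  quadratic with an equation `x_j = ((x_i ⊕ c₁) ∧ (x_k ⊕ c₂)) ⊕ c₃` over two distinct free
  variables, the right-hand sides of the quadratic equations being pairwise disjoint;
  `RdqSource.dim` (number of free variables), `RdqSource.Sol` (its solution set in `𝔽₂ⁿ`),
  `RdqSource.Protected` (free and read by a quadratic equation), `RdqSource.quadCount`.
* `Semicircuit.ComputesRestr C f R` — "`C` computes `f|_R`" (§2.3): the non-free variables of `R`
  have out-degree `0` in `C`, and `C` outputs `f` on every input in `Sol R`.
* `Semicircuit.influential C R` (Def. 3.6: `1⁺`-variables or protected) and the measure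
  `Semicircuit.measure C αφ αI αQ 𝒫 R = g + αI · i + αQ · q + αφ · Φ(C, 𝒫)` (Def. 3.6);
  `liYangDelta αφ αI αQ` — the `δ` of Thm. 4.1.

Main results.

* `LiYang2022_step` — NAMED FACT, the one-step claim of the proof of Thm. 4.1 (ECCC TR21-023,
  p. 19, proved there by Cases 0–8 of §4.1, pp. 20–40, using Lemmas 3.11, 3.12 and
  Props. 2.6–2.8): if `C` computes `f|_R` with packing `𝒫`, `f` an affine disperser for
  dimension `d`, and fewer than `n - 2d - 2` substitutions have been made (`dim R > 2d + 2`), then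
  either the circuit can be simplified without substitution (a gate fewer, `μ` not larger), or
  `1 ≤ t ≤ 3` substitutions can be performed with decrement of `μ` at least `δ` per substitution,
  the new circuit computing `f` restricted to the updated rdq-source.
* `Semicircuit.card_le_troubledCount` — `|𝒫| ≤ #troubled` for a packing, so `Φ ≥ 0`, `μ ≥ 0`.
* `measure_ge_of_step` — PROVED: the fact implies Thm. 4.1 in the generality of its proof:
  `μ(C, 𝒫, R) ≥ δ (dim R - 2d - 2)` for every fair semicircuit computing `f|_R` (induction on
  `(dim R, g)`).
* `Circuit.toSemicircuit` — an ordinary simple binary circuit (`Circuit.IsSimpleBinary`) is a fair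
  semicircuit with empty xor-part computing `f|_∅`; its size, out-degrees, troubled gates and
  influential inputs are the ones of `GateElimination.lean` (`fanout_toSemicircuit_var`,
  `troubled_toSemicircuit_iff`, `troubledCount_toSemicircuit`,
  `card_influential_toSemicircuit_free`).
* `LiYang2022_measure_ge_of_step` — PROVED: `LiYang2022_step → LiYang2022_measure_ge`
  (Thm. 4.1 at `𝒫 = ∅`, `R = ∅`, `(αφ, αI, αQ) = (0.2, 9.6, 1.8)`, `δ = 12.8`), hence
  `li_yang_of_step : LiYang2022_step → li_yang` (with `li_yang_of_measure_ge`).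

After this file the unproved input to `Literature.Computability.Complexity.li_yang` (Li–Yang Thm. 1.1) is exactly the case
analysis `LiYang2022_step`.

## References

* J. Li, T. Yang, *3.1n − o(n) circuit lower bounds for explicit functions*, STOC 2022
  [LiYang2022]; full version ECCC TR21-023: §2.1 (p. 6–7), Def. 2.2 and "computes `f|_R`"
  (p. 8–9), §2.4 (p. 9–10), Def. 2.5 and fairness (p. 10–11), Def. 3.1–3.6 (p. 13–14),
  Thm. 4.1 and its proof (p. 18–20).
* M. G. Find, A. Golovnev, E. A. Hirsch, A. S. Kulikov, *A better-than-3n lower bound for the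
  circuit complexity of an explicit function*, FOCS 2016 (rdq-sources, fair semicircuits,
  troubled gates).
-/

namespace Literature.Computability.Complexity

open Finset

/-! ### Binary gate functions (Li–Yang §2.1) -/

/-- A binary Boolean function is *∧-type*: `op a b = ((a ⊕ c₁) ∧ (b ⊕ c₂)) ⊕ c₃` for some
constants (Li–Yang §2.1; 8 of the 16 functions). [cite: LiYang2022, §2.1] -/
def IsAndOp (op : Bool → Bool → Bool) : Prop :=
  ∃ c₁ c₂ c₃ : Bool, ∀ a b : Bool, op a b = (((a ^^ c₁) && (b ^^ c₂)) ^^ c₃)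

/-- A binary Boolean function is *⊕-type*: `op a b = a ⊕ b ⊕ c` for a constant `c`
(Li–Yang §2.1). [cite: LiYang2022, §2.1] -/
def IsXorOp (op : Bool → Bool → Bool) : Prop :=
  ∃ c : Bool, ∀ a b : Bool, op a b = ((a ^^ b) ^^ c)

/-- Being ∧-type is decidable (finitely many constants). [folklore] -/
instance (op : Bool → Bool → Bool) : Decidable (IsAndOp op) := by
  unfold IsAndOp; infer_instance

/-- Being ⊕-type is decidable. [folklore] -/
instance (op : Bool → Bool → Bool) : Decidable (IsXorOp op) := by
  unfold IsXorOp; infer_instance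

/-! ### Semicircuits (Li–Yang Def. 2.5) -/

/-- A node of a semicircuit with `m` gates on `n` variables: a constant (a node of in-degree `0`
introduced by substitutions, Li–Yang §2.4: "we slightly extend the definition of circuits to
involve constants of in-degree 0 … a gate fed by a constant is either trivial or degenerate"),
an input variable, or a gate. [cite: LiYang2022, §2.4] -/
inductive Node (n m : ℕ) where
  /-- the constant `b` -/
  | const (b : Bool)
  /-- the input variable `x_i` -/
  | var (i : Fin n)
  /-- the gate `k` -/
  | gate (k : Fin m)
  deriving DecidableEq

/-- A **semicircuit** on `n` variables (Li–Yang 2022, Def. 2.5; Find–Golovnev–Hirsch–Kulikov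
2016): `m` gates, each labelled by a binary Boolean function `op j` (an arbitrary element of
`B₂`, §2.1) with two argument nodes `arg j 0`, `arg j 1` (a `Node`: a constant, an input variable
or a gate; the two arguments may coincide, cf. Rule 5 of §3.3), an output node `out`,
and the decomposition of Def. 2.5: a set `xorPart` of ⊕-type gates (the *cyclic xor-circuit* `C₁`:
its gates read only variables and gates of `C₁`, cycles allowed) whose complement is an acyclic
circuit `C₂` (it may read variables, gates of `C₁`, and gates of `C₂` of smaller rank). An
ordinary `B₂`-circuit is the case `xorPart = ∅` (and no constant nodes).
[cite: LiYang2022, Def. 2.5] -/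
structure Semicircuit (n : ℕ) where
  /-- The number of gates `g` (of both parts). -/
  m : ℕ
  /-- The binary Boolean function labelling gate `j`. -/
  op : Fin m → Bool → Bool → Bool
  /-- The two argument nodes of gate `j`. -/
  arg : Fin m → Fin 2 → Node n m
  /-- The output node. -/
  out : Node n m
  /-- The gates of the cyclic xor-circuit `C₁`. -/
  xorPart : Finset (Fin m)
  /-- `C₁` consists of ⊕-type gates. -/
  isXorOp_of_mem : ∀ j ∈ xorPart, IsXorOp (op j)
  /-- `C₁` is fed only by variables, constants, and gates of `C₁`. -/
  mem_of_arg_eq : ∀ j ∈ xorPart, ∀ (a : Fin 2) (k : Fin m), arg j a = .gate k → k ∈ xorPart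
  /-- `C₂ = xorPartᶜ` is acyclic: some rank strictly increases along every wire between gates
  of `C₂`. -/
  acyclic : ∃ ρ : Fin m → ℕ, ∀ j, j ∉ xorPart → ∀ (a : Fin 2) (k : Fin m),
    arg j a = .gate k → k ∉ xorPart → ρ k < ρ j

namespace Semicircuit

variable {n : ℕ} (C : Semicircuit n)

/-- The value of a node, given the input `x` and gate values `w`. [cite: LiYang2022, §2.5] -/
def nodeVal (x : Fin n → Bool) (w : Fin C.m → Bool) : Node n C.m → Bool
  | .const b => b
  | .var i => x i
  | .gate k => w k

/-- `w` solves the gate equations of `C` on input `x`: `w j = op j (arg j 0) (arg j 1)` for every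
gate (the linear system `A g = b` of §2.5 together with the equations of the acyclic part).
[cite: LiYang2022, §2.5] -/
def Consistent (x : Fin n → Bool) (w : Fin C.m → Bool) : Prop :=
  ∀ j, w j = C.op j (C.nodeVal x w (C.arg j 0)) (C.nodeVal x w (C.arg j 1))

/-- Consistency of gate values is decidable. [folklore] -/
instance (x : Fin n → Bool) (w : Fin C.m → Bool) : Decidable (C.Consistent x w) := by
  unfold Consistent; infer_instance

/-- `C` is **fair**: for every assignment of the input variables the gate equations have exactly
one solution (Li–Yang §2.5: "the cyclic xor-circuit is fair if `A` is of full rank, i.e. this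
system of linear equations has a unique solution for any assignment of input variables. A
semicircuit is fair if the cyclic xor-circuit is fair"; the acyclic part is then determined).
This is a PREDICATE on semicircuits — the standing hypothesis `(hF : C.Fair)` of the
gate-elimination induction (the paper's "we abuse the notation circuit to mean fair
semicircuit") — not a claim: `Semicircuit.exists_not_fair` below is a one-gate cyclic
xor-circuit that is not fair. The equivalence with the printed full-rank condition is proved in
`GateEliminationAffine.lean` (`Fair.xor_unique`, `XorConsistent.exists_consistent`) and
`GateEliminationXorMap.lean` (`fair_of_xorPart`, `Fair.xorMap_injective`,
`Fair.xorMap_surjective`). [cite: LiYang2022, §2.5] -/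
def Fair (C : Semicircuit n) : Prop :=
  ∀ x : Fin n → Bool, ∃! w : Fin C.m → Bool, C.Consistent x w

/-- **Fairness is a genuine restriction**: the cyclic xor-circuit with the single gate
`G = G ⊕ x₀` (its matrix `A = (0)` is singular) is a semicircuit that is not fair — on input
`x₀ = 1` its gate equation `G = G ⊕ 1` has no solution (and on `x₀ = 0` it has two). [folklore] -/
theorem exists_not_fair : ∃ C : Semicircuit 1, ¬ C.Fair := by
  refine ⟨
    { m := 1
      op := fun _ a b => (a ^^ b)
      arg := fun _ a => if a = 0 then Node.gate 0 else Node.var 0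
      out := Node.gate 0
      xorPart := {0}
      isXorOp_of_mem := fun _ _ => ⟨false, fun a b => by cases a <;> cases b <;> rfl⟩
      mem_of_arg_eq := fun _ _ _ k _ => Finset.mem_singleton.mpr (Subsingleton.elim k 0)
      acyclic := ⟨fun _ => 0, fun j hj =>
        absurd (Finset.mem_singleton.mpr (Subsingleton.elim j 0)) hj⟩ },
    fun hF => ?_⟩
  obtain ⟨w, hw, -⟩ := hF fun _ => true
  have h0 := hw 0
  simp only [Fin.isValue, ↓reduceIte, one_ne_zero, nodeVal] at h0
  revert h0
  cases w 0 <;> decide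

/-- The *out-degree* of a node: the number of argument positions of gates wired to it
(Li–Yang §2.1: "`k`-gate", "`k`-variable"; being the output is not an edge).
[cite: LiYang2022, §2.1] -/
def fanout (v : Node n C.m) : ℕ :=
  ∑ j : Fin C.m, (univ.filter fun a : Fin 2 => C.arg j a = v).card

/-- Gate `j` is **troubled**: an ∧-type gate of out-degree `1` fed by two distinct variables of
out-degree `2` (Li–Yang Def. 3.1; as `Circuit.IsTroubled`). [cite: LiYang2022, Def. 3.1] -/
def Troubled (j : Fin C.m) : Prop :=
  IsAndOp (C.op j) ∧ C.fanout (.gate j) = 1 ∧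
    ∃ x y : Fin n, x ≠ y ∧ Set.range (C.arg j) = {Node.var x, Node.var y} ∧
      C.fanout (.var x) = 2 ∧ C.fanout (.var y) = 2

open Classical in
/-- The number of troubled gates of `C`. [cite: LiYang2022, Def. 3.1] -/
noncomputable def troubledCount : ℕ :=
  (univ.filter fun j => C.Troubled j).card

/-- Two gates are *adjacent* if they share an input variable (Li–Yang Def. 3.1).
[cite: LiYang2022, Def. 3.1] -/
def Adjacent (j j' : Fin C.m) : Prop :=
  ∃ x : Fin n, (∃ a, C.arg j a = .var x) ∧ (∃ a, C.arg j' a = .var x)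

/-- Adjacency is decidable. [folklore] -/
instance (j j' : Fin C.m) : Decidable (C.Adjacent j j') := by
  unfold Adjacent; infer_instance

/-- `P` is a **packing** of `C` (Li–Yang Def. 3.2–3.3): a set of *troubled pairs* — pairs
`(G, G')` of two distinct adjacent troubled gates — which are pairwise disjoint (no gate lies in
two packs; in particular a pack and its reversal are not both present). [cite: LiYang2022, Def. 3.3] -/
def IsPacking (P : Finset (Fin C.m × Fin C.m)) : Prop :=
  (∀ p ∈ P, p.1 ≠ p.2 ∧ C.Troubled p.1 ∧ C.Troubled p.2 ∧ C.Adjacent p.1 p.2) ∧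
    ∀ p ∈ P, ∀ p' ∈ P, p ≠ p' → p.1 ≠ p'.1 ∧ p.1 ≠ p'.2 ∧ p.2 ≠ p'.1 ∧ p.2 ≠ p'.2

/-- The **potential** `Φ(C, 𝒫)`: the number of troubled gates minus `|𝒫|` (Li–Yang Def. 3.5).
[cite: LiYang2022, Def. 3.5] -/
noncomputable def potential (P : Finset (Fin C.m × Fin C.m)) : ℝ :=
  (C.troubledCount : ℝ) - P.card

end Semicircuit

/-! ### Rdq-sources (Li–Yang Def. 2.2) -/

/-- An affine equation `x_j = ⊕_{i ∈ support} x_i ⊕ c` of an rdq-source. [cite: LiYang2022, Def. 2.2] -/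
structure LinEq (n : ℕ) where
  /-- The variables on the right-hand side (free or quadratic variables). -/
  support : Finset (Fin n)
  /-- The constant term. -/
  c : ZMod 2

/-- A quadratic equation `x_j = ((x_i ⊕ c₁) ∧ (x_k ⊕ c₂)) ⊕ c₃` of an rdq-source. [cite: LiYang2022, Def. 2.2] -/
structure QuadEq (n : ℕ) where
  /-- The first free variable read. -/
  i : Fin n
  /-- Its shift. -/
  c₁ : ZMod 2
  /-- The second free variable read. -/
  k : Fin n
  /-- Its shift. -/
  c₂ : ZMod 2
  /-- The constant term. -/
  c₃ : ZMod 2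

/-- A **read-once depth-two quadratic source** on the variables `x_0, …, x_{n-1}` (Li–Yang 2022,
Def. 2.2; FGHK 2016): every variable is *free* (no equation), *linear* (`lin j = some e`: the
affine equation `x_j = ⊕_{i ∈ e.support} x_i ⊕ e.c` whose right-hand side consists of free and
quadratic variables) or *quadratic* (`quad j = some e`:
`x_j = ((x_{e.i} ⊕ e.c₁) ∧ (x_{e.k} ⊕ e.c₂)) ⊕ e.c₃` with `e.i ≠ e.k` free), and the source is
read-once: the right-hand sides of distinct quadratic equations are disjoint.
[cite: LiYang2022, Def. 2.2] -/
structure RdqSource (n : ℕ) where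
  /-- The affine equation of a linear variable (`none` otherwise). -/
  lin : Fin n → Option (LinEq n)
  /-- The quadratic equation of a quadratic variable (`none` otherwise). -/
  quad : Fin n → Option (QuadEq n)
  /-- A variable is not both linear and quadratic. -/
  lin_or_quad : ∀ j, lin j = none ∨ quad j = none
  /-- Right-hand sides of affine equations consist of free and quadratic variables. -/
  lin_wf : ∀ j e, lin j = some e → ∀ i ∈ e.support, lin i = none
  /-- Right-hand sides of quadratic equations are two distinct free variables. -/
  quad_wf : ∀ j e, quad j = some e →
    (lin e.i = none ∧ quad e.i = none) ∧ (lin e.k = none ∧ quad e.k = none) ∧ e.i ≠ e.k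
  /-- Read-once: distinct quadratic equations read disjoint sets of variables. -/
  read_once : ∀ j j' e e', quad j = some e → quad j' = some e' → j ≠ j' →
    e.i ≠ e'.i ∧ e.i ≠ e'.k ∧ e.k ≠ e'.i ∧ e.k ≠ e'.k

namespace RdqSource

variable {n : ℕ} (R : RdqSource n)

/-- `x_j` is a free variable of `R`. [cite: LiYang2022, Def. 2.2] -/
def Free (j : Fin n) : Prop := R.lin j = none ∧ R.quad j = none

/-- Freeness is decidable. [folklore] -/
instance (j : Fin n) : Decidable (R.Free j) := by
  unfold Free; infer_instance

/-- The dimension of `R`: its number of free variables. [cite: LiYang2022, Def. 2.2] -/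
def dim : ℕ := (univ.filter fun j => R.Free j).card

/-- The number `q` of quadratic equations of `R`. [cite: LiYang2022, Def. 3.6] -/
def quadCount : ℕ := (univ.filter fun j => (R.quad j).isSome).card

/-- `x_j` is *protected*: a free variable occurring on the right-hand side of a quadratic equation
(Li–Yang §2.3). [cite: LiYang2022, §2.3] -/
def Protected (j : Fin n) : Prop :=
  R.Free j ∧ ∃ (j' : Fin n) (e : QuadEq n), R.quad j' = some e ∧ (e.i = j ∨ e.k = j)

/-- The subset of `𝔽₂ⁿ` defined by `R`: the assignments satisfying all its equations
(of size `2 ^ dim`; Li–Yang §2.3). [cite: LiYang2022, §2.3] -/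
def Sol : Set (Fin n → ZMod 2) :=
  {v | (∀ j e, R.lin j = some e → v j = e.c + ∑ i ∈ e.support, v i) ∧
    ∀ j e, R.quad j = some e → v j = (v e.i + e.c₁) * (v e.k + e.c₂) + e.c₃}

/-- The empty rdq-source `∅`: every variable free, no equations. [cite: LiYang2022, Thm. 4.1] -/
def free (n : ℕ) : RdqSource n where
  lin _ := none
  quad _ := none
  lin_or_quad _ := Or.inl rfl
  lin_wf _ _ h := by simp at h
  quad_wf _ _ h := by simp at h
  read_once _ _ _ _ h := by simp at h

end RdqSource

namespace Semicircuit

variable {n : ℕ} (C : Semicircuit n)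

/-- **`C` computes `f|_R`** (Li–Yang §2.3): the linear and quadratic variables of `R` are
`0`-variables of `C`, and `C` outputs `f` on every input satisfying the equations of `R`
(inputs are read in `Bool` through `boolOfZMod2`; for a fair `C` the gate values `w` are unique).
[cite: LiYang2022, §2.3] -/
def ComputesRestr (f : (Fin n → ZMod 2) → Bool) (R : RdqSource n) : Prop :=
  (∀ j, ¬ R.Free j → C.fanout (.var j) = 0) ∧
    ∀ v ∈ R.Sol, ∀ w : Fin C.m → Bool, C.Consistent (Literature.Computability.Complexity.boolOfZMod2.symm v) w →
      C.nodeVal (Literature.Computability.Complexity.boolOfZMod2.symm v) w C.out = f v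

open Classical in
/-- The *influential* inputs of `C` with respect to `R`: variables of out-degree `≥ 1` or
protected (Li–Yang Def. 3.6). [cite: LiYang2022, Def. 3.6] -/
noncomputable def influential (R : RdqSource n) : Finset (Fin n) :=
  univ.filter fun j => 1 ≤ C.fanout (.var j) ∨ R.Protected j

/-- The **circuit complexity measure** `μ(C, 𝒫, R) = g + α_I · i + α_Q · q + α_φ · Φ(C, 𝒫)`
(Li–Yang Def. 3.6): `g` gates, `i` influential inputs, `q` quadratic equations.
[cite: LiYang2022, Def. 3.6] -/
noncomputable def measure (αφ αI αQ : ℝ) (P : Finset (Fin C.m × Fin C.m)) (R : RdqSource n) : ℝ :=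
  (C.m : ℝ) + αI * (C.influential R).card + αQ * R.quadCount + αφ * C.potential P

end Semicircuit

/-- The constant `δ = α_I + min{α_I/3, 2 - 2α_φ + α_Q, 4 - 4α_φ, 3 + α_φ, 5 - α_Q,
(5 - 2α_φ + α_Q)/2}` of Li–Yang Thm. 4.1. [cite: LiYang2022, Thm. 4.1] -/
noncomputable def liYangDelta (αφ αI αQ : ℝ) : ℝ :=
  αI + min (αI / 3) (min (2 - 2 * αφ + αQ) (min (4 - 4 * αφ) (min (3 + αφ) (min (5 - αQ)
    ((5 - 2 * αφ + αQ) / 2)))))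

end Literature.Computability.Complexity

namespace Literature.Computability.Complexity

open Finset

/-- **The one-step claim of the proof of Li–Yang's Theorem 4.1** (ECCC TR21-023, p. 19):
"if `k < n - 2d - 2` substitutions have been applied to the circuit such that the resulting
circuit `C` computes `f|_R` with packing `𝒫`, either it is possible to simplify the circuit
(i.e. decrease the complexity measure) without performing substitution, or it is possible to
perform `1 ≤ t ≤ 3` substitutions with complexity measure decrement `≥ δ` per substitution, while
the simplified circuit `C'` remains to compute `f` restricting to the updated rdq-source."
Here "circuit" means fair semicircuit (§2.5), `f : 𝔽₂ⁿ → {0,1}` is an affine disperser for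
dimension `d`, `k = n - dim R` (every substitution turns exactly one free variable into a linear
or quadratic one, §2.4), the parameters are positive with `α_φ < 1/2` (Def. 3.6, Lemma 3.11),
`δ = liYangDelta`, and the simplification without substitution (Cases 0.1–0.3 of §4.1:
a normalisation rule, removal of a gate from which the output is unreachable, replacement of a
constant gate, each followed by the normalisations removing the constants) removes at least one
gate with `Δμ ≥ 0` (Lemma 3.11, `α_φ < 1/2`), the rdq-source being unchanged; after
substitutions the new circuit is again a fair semicircuit (Props. 2.6, 2.8) with a packing of
its own choosing (Rule 1: "we pack them together"). The case analysis proving it (§4.1,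
Cases 0–8, pp. 20–40, with Lemma 3.11 (normalisation), Lemma 3.12 (troubled pair elimination)
and Props. 2.6–2.8 (substitutions, xor-reconstruction)) applies to an arbitrary fair
semicircuit computing `f|_R` with an arbitrary packing — it uses nothing about how `(C, 𝒫, R)`
arose — which is how the claim is vendored here. NAMED FACT, not proved here.
[cite: LiYang2022, proof of Thm. 4.1 (§4.1, p. 19)] -/
def LiYang2022_step : Prop :=
  ∀ (αφ αI αQ : ℝ), 0 < αφ → αφ < 1 / 2 → 0 < αI → 0 < αQ →
  ∀ (n d : ℕ) (f : (Fin n → ZMod 2) → Bool), IsAffineDisperser f d →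
  ∀ (C : Semicircuit n) (R : RdqSource n) (P : Finset (Fin C.m × Fin C.m)),
    C.Fair → C.ComputesRestr f R → C.IsPacking P → 2 * d + 2 < R.dim →
    (∃ (C' : Semicircuit n) (P' : Finset (Fin C'.m × Fin C'.m)),
        C'.Fair ∧ C'.ComputesRestr f R ∧ C'.IsPacking P' ∧ C'.m < C.m ∧
          C'.measure αφ αI αQ P' R ≤ C.measure αφ αI αQ P R) ∨
    (∃ t : ℕ, 1 ≤ t ∧ t ≤ 3 ∧
      ∃ (C' : Semicircuit n) (R' : RdqSource n) (P' : Finset (Fin C'.m × Fin C'.m)),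
        C'.Fair ∧ C'.ComputesRestr f R' ∧ C'.IsPacking P' ∧ R'.dim + t = R.dim ∧
          liYangDelta αφ αI αQ * t ≤ C.measure αφ αI αQ P R - C'.measure αφ αI αQ P' R')

/-! ### `Φ ≥ 0`, `μ ≥ 0` -/

/-- A packing has at most as many packs as there are troubled gates (the first components of the
packs are pairwise distinct troubled gates); hence `Φ(C, 𝒫) ≥ 0`. [cite: LiYang2022, Def. 3.5] -/
theorem Semicircuit.card_le_troubledCount {n : ℕ} (C : Semicircuit n)
    {P : Finset (Fin C.m × Fin C.m)} (hP : C.IsPacking P) : P.card ≤ C.troubledCount := by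
  classical
  unfold Semicircuit.troubledCount
  refine Finset.card_le_card_of_injOn Prod.fst (fun p hp => ?_) fun p hp p' hp' h => ?_
  · simp only [coe_filter, mem_univ, true_and, Set.mem_setOf_eq]
    exact (hP.1 p hp).2.1
  · by_contra hne
    exact (hP.2 p hp p' hp' hne).1 h

/-- `Φ(C, 𝒫) ≥ 0` for a packing. [cite: LiYang2022, Def. 3.5] -/
theorem Semicircuit.potential_nonneg {n : ℕ} (C : Semicircuit n)
    {P : Finset (Fin C.m × Fin C.m)} (hP : C.IsPacking P) : 0 ≤ C.potential P := by
  unfold Semicircuit.potential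
  have := C.card_le_troubledCount hP
  have : (P.card : ℝ) ≤ C.troubledCount := by exact_mod_cast this
  linarith

/-- `μ(C, 𝒫, R) ≥ 0` for a packing and nonnegative parameters. [cite: LiYang2022, Def. 3.6] -/
theorem Semicircuit.measure_nonneg {n : ℕ} (C : Semicircuit n)
    {αφ αI αQ : ℝ} (hφ : 0 ≤ αφ) (hI : 0 ≤ αI) (hQ : 0 ≤ αQ)
    {P : Finset (Fin C.m × Fin C.m)} (hP : C.IsPacking P) (R : RdqSource n) :
    0 ≤ C.measure αφ αI αQ P R := by
  unfold Semicircuit.measure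
  have h1 := C.potential_nonneg hP
  positivity

/-! ### Theorem 4.1 from the one-step claim -/

/-- **Li–Yang's Theorem 4.1 in the generality of its proof, from the one-step claim**: for
positive parameters with `α_φ < 1/2` and `δ ≥ 0`, every fair semicircuit `C` computing `f|_R`
(`f` an affine disperser for dimension `d`) with a packing `𝒫` satisfies
`μ(C, 𝒫, R) ≥ δ · (dim R - 2d - 2)`. Proof: induction on `(dim R, g)`; while `dim R > 2d + 2`
apply `LiYang2022_step`; at the end `μ ≥ 0` (Li–Yang 2022, proof of Thm. 4.1, p. 19).
[cite: LiYang2022, Thm. 4.1] -/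
theorem measure_ge_of_step (h : LiYang2022_step) {αφ αI αQ : ℝ} (hφ : 0 < αφ) (hφ' : αφ < 1 / 2)
    (hI : 0 < αI) (hQ : 0 < αQ) (hδ : 0 ≤ liYangDelta αφ αI αQ)
    {n d : ℕ} {f : (Fin n → ZMod 2) → Bool} (hf : IsAffineDisperser f d)
    (C : Semicircuit n) (R : RdqSource n) (P : Finset (Fin C.m × Fin C.m))
    (hF : C.Fair) (hC : C.ComputesRestr f R) (hP : C.IsPacking P) :
    liYangDelta αφ αI αQ * ((R.dim : ℝ) - 2 * d - 2) ≤ C.measure αφ αI αQ P R := by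
  -- induction on `dim R`, then on the number of gates
  suffices key : ∀ (r : ℕ) (C : Semicircuit n) (R : RdqSource n) (P : Finset (Fin C.m × Fin C.m)),
      R.dim = r → C.Fair → C.ComputesRestr f R → C.IsPacking P →
        liYangDelta αφ αI αQ * ((R.dim : ℝ) - 2 * d - 2) ≤ C.measure αφ αI αQ P R from
    key _ C R P rfl hF hC hP
  intro r
  induction r using Nat.strong_induction_on with
  | _ r ihr =>
    suffices key' : ∀ (g : ℕ) (C : Semicircuit n) (R : RdqSource n)
        (P : Finset (Fin C.m × Fin C.m)), C.m = g → R.dim = r → C.Fair → C.ComputesRestr f R →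
          C.IsPacking P →
            liYangDelta αφ αI αQ * ((R.dim : ℝ) - 2 * d - 2) ≤ C.measure αφ αI αQ P R from
      fun C R P hr hF hC hP => key' _ C R P rfl hr hF hC hP
    intro g
    induction g using Nat.strong_induction_on with
    | _ g ihg =>
      intro C R P hg hr hF hC hP
      by_cases hdim : 2 * d + 2 < R.dim
      · rcases h αφ αI αQ hφ hφ' hI hQ n d f hf C R P hF hC hP hdim with
          ⟨C', P', hF', hC', hP', hm, hμ⟩ | ⟨t, ht1, ht3, C', R', P', hF', hC', hP', hdim', hμ⟩
        · have := ihg C'.m (hg ▸ hm) C' R P' rfl hr hF' hC' hP'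
          linarith
        · have hlt : R'.dim < r := by omega
          have := ihr R'.dim hlt C' R' P' rfl hF' hC' hP'
          have hcast : (R.dim : ℝ) = R'.dim + t := by exact_mod_cast hdim'.symm
          rw [hcast]
          nlinarith
      · have h0 := C.measure_nonneg hφ.le hI.le hQ.le hP R
        have h1 : (R.dim : ℝ) - 2 * d - 2 ≤ 0 := by
          have : (R.dim : ℝ) ≤ 2 * d + 2 := by exact_mod_cast not_lt.mp hdim
          linarith
        nlinarith

end Literature.Computability.Complexity

/-! ### Ordinary circuits as fair semicircuits -/

namespace Literature.Computability.Complexity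

namespace Circuit

open Finset

variable {n : ℕ}

/-- Forgetting the bound of a gate node: `var i ↦ inl (inl i)`, `gate k ↦ inl (inr k.val)`,
`const b ↦ inr b` (from semicircuit nodes to H21 wires, constants kept apart). [folklore] -/
def nodeWire (m : ℕ) : Node n m → (Fin n ⊕ ℕ) ⊕ Bool
  | .const b => .inr b
  | .var i => .inl (.inl i)
  | .gate k => .inl (.inr k.val)

/-- `nodeWire` is injective. [folklore] -/
theorem nodeWire_injective (m : ℕ) : Function.Injective (nodeWire (n := n) m) := by
  intro v v' h
  cases v <;> cases v' <;> simp only [nodeWire, Sum.inl.injEq, Sum.inr.injEq, reduceCtorEq] at h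
  · rw [h]
  · rw [h]
  · rw [Fin.ext h]

/-- `nodeWire` on a variable. [folklore] -/
@[simp] theorem nodeWire_var (m : ℕ) (i : Fin n) : nodeWire m (.var i) = .inl (.inl i) := rfl

/-- `nodeWire` on a gate. [folklore] -/
@[simp] theorem nodeWire_gate (m : ℕ) (k : Fin m) :
    nodeWire (n := n) m (.gate k) = .inl (.inr k.val) := rfl

/-- `nodeWire` on a constant. [folklore] -/
@[simp] theorem nodeWire_const (m : ℕ) (b : Bool) : nodeWire (n := n) m (.const b) = .inr b := rfl

/-- The node of the semicircuit read by argument `a` of gate `j` of an H21 circuit: the wire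
`Sum.inr k` points to an earlier gate `k < j`, hence to a gate. [folklore] -/
def wireNode (C : Circuit (Fin n)) (j : Fin C.gates.length) (a : Fin (C.gates[(j : ℕ)]).arity) :
    Node n C.gates.length :=
  match h : (C.gates[(j : ℕ)]).args a with
  | .inl i => .var i
  | .inr k => .gate ⟨k, (C.wf j j.isLt a k h).trans j.isLt⟩

/-- `wireNode` forgets to the wire. [folklore] -/
theorem nodeWire_wireNode (C : Circuit (Fin n)) (j : Fin C.gates.length)
    (a : Fin (C.gates[(j : ℕ)]).arity) :
    nodeWire _ (C.wireNode j a) = .inl ((C.gates[(j : ℕ)]).args a) := by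
  unfold wireNode
  split <;> simp_all

/-- `wireNode j a = v` iff the wire of `v` is the wire read. [folklore] -/
theorem wireNode_eq_iff (C : Circuit (Fin n)) (j : Fin C.gates.length)
    (a : Fin (C.gates[(j : ℕ)]).arity) (v : Node n C.gates.length) :
    C.wireNode j a = v ↔ Sum.inl ((C.gates[(j : ℕ)]).args a) = nodeWire _ v := by
  rw [← nodeWire_wireNode]
  exact (nodeWire_injective _).eq_iff.symm

/-- A gate wire of gate `j` points below `j`. [folklore] -/
theorem wireNode_lt (C : Circuit (Fin n)) (j : Fin C.gates.length)
    (a : Fin (C.gates[(j : ℕ)]).arity) (k : Fin C.gates.length) (h : C.wireNode j a = .gate k) :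
    k.val < j.val := by
  have h' := (C.wireNode_eq_iff j a _).mp h
  rw [nodeWire_gate, Sum.inl.injEq] at h'
  exact C.wf j j.isLt a k h'

/-- The output node of an H21 circuit (the output wire points to an existing gate). [folklore] -/
def outNode (C : Circuit (Fin n)) : Node n C.gates.length :=
  match h : C.output with
  | .inl i => .var i
  | .inr k => .gate ⟨k, C.wf_output k h⟩

/-- `outNode` forgets to the output wire. [folklore] -/
theorem nodeWire_outNode (C : Circuit (Fin n)) : nodeWire _ C.outNode = .inl C.output := by
  unfold outNode
  split <;> simp_all

/-- **An ordinary simple binary circuit as a semicircuit** (Li–Yang Def. 2.5 with empty cyclic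
xor-part): gate `j` keeps its binary truth table `btable` and its two wires; the rank function
is the program order. [cite: LiYang2022, Def. 2.5] -/
abbrev toSemicircuit (C : Circuit (Fin n)) (hS : C.IsSimpleBinary) : Semicircuit n where
  m := C.gates.length
  op j := btable (C.gates[(j : ℕ)])
  arg j a := C.wireNode j (Fin.cast (hS _ (List.getElem_mem j.isLt)).1.symm a)
  out := C.outNode
  xorPart := ∅
  isXorOp_of_mem j hj := by simp at hj
  mem_of_arg_eq j hj := by simp at hj
  acyclic := ⟨fun j => j, fun j _ a k hk _ => C.wireNode_lt j _ k hk⟩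

section ToSemicircuit

variable (C : Circuit (Fin n)) (hS : C.IsSimpleBinary)

/-- The semicircuit has as many gates as the circuit. [folklore] -/
@[simp] theorem toSemicircuit_m : (C.toSemicircuit hS).m = C.gates.length := rfl

/-- Out-degrees are preserved (for variables and gates; constants do not occur). [folklore] -/
theorem fanout_toSemicircuit (v : Node n C.gates.length) (w : Fin n ⊕ ℕ)
    (hvw : nodeWire _ v = .inl w) : (C.toSemicircuit hS).fanout v = C.fanout w := by
  rw [fanout_eq_sum, Semicircuit.fanout]
  refine Finset.sum_congr rfl fun j _ => ?_
  have h2 := (hS _ (List.getElem_mem j.isLt)).1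
  refine Finset.card_equiv (finCongr h2.symm) fun a => ?_
  simp only [mem_filter, mem_univ, true_and, finCongr_apply]
  rw [C.wireNode_eq_iff j _ v, hvw, Sum.inl.injEq]

/-- Out-degrees of variables are preserved. [folklore] -/
theorem fanout_toSemicircuit_var (i : Fin n) :
    (C.toSemicircuit hS).fanout (.var i) = C.fanout (.inl i) :=
  C.fanout_toSemicircuit hS _ _ rfl

/-- Out-degrees of gates are preserved. [folklore] -/
theorem fanout_toSemicircuit_gate (k : Fin C.gates.length) :
    (C.toSemicircuit hS).fanout (.gate k) = C.fanout (.inr k.val) :=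
  C.fanout_toSemicircuit hS _ _ rfl

/-- The set of argument nodes of gate `j` forgets to the set of its wires. [folklore] -/
theorem range_arg_toSemicircuit (j : Fin C.gates.length) :
    nodeWire _ '' Set.range ((C.toSemicircuit hS).arg j) =
      Sum.inl '' Set.range (C.gates[(j : ℕ)]).args := by
  have h2 := (hS _ (List.getElem_mem j.isLt)).1
  rw [← Set.range_comp, ← Set.range_comp]
  ext w
  simp only [Set.mem_range, Function.comp_apply]
  constructor
  · rintro ⟨a, rfl⟩
    exact ⟨_, (C.nodeWire_wireNode j _).symm⟩
  · rintro ⟨a, rfl⟩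
    exact ⟨finCongr h2 a, by simp [nodeWire_wireNode]⟩

/-- Troubled gates are preserved. [cite: LiYang2022, Def. 3.1] -/
theorem troubled_toSemicircuit_iff (j : Fin C.gates.length) :
    (C.toSemicircuit hS).Troubled j ↔ C.IsTroubled j.val := by
  have h2 := (hS _ (List.getElem_mem j.isLt)).1
  have hinl : Function.Injective (Set.image (Sum.inl : Fin n ⊕ ℕ → (Fin n ⊕ ℕ) ⊕ Bool)) :=
    Set.image_injective.mpr Sum.inl_injective
  have hrange : ∀ x y : Fin n,
      Set.range ((C.toSemicircuit hS).arg j) = {Node.var x, Node.var y} ↔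
        Set.range (C.gates[(j : ℕ)]).args = {Sum.inl x, Sum.inl y} := by
    intro x y
    constructor
    · intro h
      have := congrArg (Set.image (nodeWire (n := n) C.gates.length)) h
      rw [C.range_arg_toSemicircuit hS j, Set.image_pair] at this
      apply hinl
      rw [this, Set.image_pair]
      simp
    · intro h
      apply Set.image_injective.mpr (nodeWire_injective (n := n) C.gates.length)
      rw [C.range_arg_toSemicircuit hS j, h, Set.image_pair, Set.image_pair]
      simp
  unfold Semicircuit.Troubled IsTroubled
  constructor
  · rintro ⟨hand, h1, x, y, hxy, hr, hx, hy⟩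
    rw [fanout_toSemicircuit_gate] at h1
    rw [fanout_toSemicircuit_var] at hx hy
    exact ⟨j.isLt, ⟨h2, hand⟩, h1, x, y, hxy, (hrange x y).mp hr, hx, hy⟩
  · rintro ⟨hj, hand, h1, x, y, hxy, hr, hx, hy⟩
    refine ⟨hand.2, ?_, x, y, hxy, (hrange x y).mpr hr, ?_, ?_⟩
    · rw [fanout_toSemicircuit_gate]; exact h1
    · rw [fanout_toSemicircuit_var]; exact hx
    · rw [fanout_toSemicircuit_var]; exact hy

/-- The number of troubled gates is preserved. [cite: LiYang2022, Def. 3.1] -/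
theorem troubledCount_toSemicircuit :
    (C.toSemicircuit hS).troubledCount = C.troubledCount := by
  classical
  unfold Semicircuit.troubledCount troubledCount
  rw [Finset.card_filter_range_eq_card_filter_univ]
  congr 1
  exact Finset.filter_congr fun j _ => C.troubled_toSemicircuit_iff hS j

/-- For the empty rdq-source the influential inputs are the `1⁺`-variables. [cite: LiYang2022, Def. 3.6] -/
theorem card_influential_toSemicircuit_free :
    ((C.toSemicircuit hS).influential (RdqSource.free n)).card = C.influentialCount := by
  classical
  unfold Semicircuit.influential influentialCount
  congr 1
  refine Finset.filter_congr fun j _ => ?_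
  rw [fanout_toSemicircuit_var]
  constructor
  · rintro (h | ⟨-, j', e, he, -⟩)
    · exact h
    · simp [RdqSource.free] at he
  · exact fun h => Or.inl h

/-! #### Semantics: the transcript is the unique solution of the gate equations -/

/-- Node values computed from a value list `L` agreeing with `w`. [folklore] -/
theorem nodeVal_eq_wireVal (x : Fin n → Bool) (w : Fin C.gates.length → Bool) (L : List Bool)
    (hL : ∀ k : Fin C.gates.length, L.getD k false = w k) (v : Node n C.gates.length)
    (w' : Fin n ⊕ ℕ) (hv : nodeWire _ v = .inl w') :
    (C.toSemicircuit hS).nodeVal x w v = wireVal x L w' := by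
  cases v with
  | const b => simp at hv
  | var i =>
    rw [nodeWire_var, Sum.inl.injEq] at hv
    subst hv
    rfl
  | gate k =>
    rw [nodeWire_gate, Sum.inl.injEq] at hv
    subst hv
    exact (hL k).symm

/-- Node values of argument nodes, computed from a value list `L` agreeing with `w`. [folklore] -/
theorem nodeVal_wireNode (x : Fin n → Bool) (w : Fin C.gates.length → Bool) (L : List Bool)
    (hL : ∀ k : Fin C.gates.length, L.getD k false = w k) (j : Fin C.gates.length)
    (a : Fin (C.gates[(j : ℕ)]).arity) :
    (C.toSemicircuit hS).nodeVal x w (C.wireNode j a) = wireVal x L ((C.gates[(j : ℕ)]).args a) :=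
  C.nodeVal_eq_wireVal hS x w L hL _ _ (C.nodeWire_wireNode j a)

/-- The gate equation of gate `j` of the semicircuit, read on a value list. [folklore] -/
theorem op_nodeVal_eq_gateValue (x : Fin n → Bool) (w : Fin C.gates.length → Bool)
    (L : List Bool) (hL : ∀ k : Fin C.gates.length, L.getD k false = w k)
    (j : Fin C.gates.length) :
    (C.toSemicircuit hS).op j ((C.toSemicircuit hS).nodeVal x w ((C.toSemicircuit hS).arg j 0))
        ((C.toSemicircuit hS).nodeVal x w ((C.toSemicircuit hS).arg j 1)) =
      gateValue x L (C.gates[(j : ℕ)]) := by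
  have h2 := (hS _ (List.getElem_mem j.isLt)).1
  rw [Gate.gateValue_eq_btable h2]
  show btable _ _ _ = _
  congr 1
  · exact C.nodeVal_wireNode hS x w L hL j _
  · exact C.nodeVal_wireNode hS x w L hL j _

/-- The transcript solves the gate equations. [cite: AroraBarak2009, Rem. 6.4] -/
theorem consistent_transcript (x : Fin n → Bool) :
    (C.toSemicircuit hS).Consistent x
      fun k : Fin C.gates.length => (transcript x [] C.gates).getD (k : ℕ) false := by
  intro j
  refine (getD_transcript_eq_gateValue C x j j.isLt).trans ?_
  exact (C.op_nodeVal_eq_gateValue hS x _ (transcript x [] C.gates) (fun k => rfl) j).symm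

/-- Any solution of the gate equations is the transcript. [cite: Burgisser2000, proof of Prop. 2.20] -/
theorem eq_transcript_of_consistent (x : Fin n → Bool) (w : Fin C.gates.length → Bool)
    (hw : (C.toSemicircuit hS).Consistent x w) :
    w = fun k : Fin C.gates.length => (transcript x [] C.gates).getD (k : ℕ) false := by
  set L := List.ofFn w with hL
  have hLget : ∀ k : Fin C.gates.length, L.getD k false = w k := by
    intro k
    rw [List.getD_eq_getElem?_getD, hL, List.getElem?_ofFn]
    simp [k.isLt]
  have hLT : L = transcript x [] C.gates := by
    refine eq_transcript_of_gate_equations C x L (by simp [hL]) fun j hj => ?_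
    exact ((hLget ⟨j, hj⟩).trans (hw ⟨j, hj⟩)).trans (C.op_nodeVal_eq_gateValue hS x w L hLget ⟨j, hj⟩)
  funext k
  rw [← hLget k, hLT]

/-- **An ordinary circuit is a fair semicircuit.** [cite: LiYang2022, §2.5] -/
theorem fair_toSemicircuit : (C.toSemicircuit hS).Fair := fun x =>
  ⟨_, C.consistent_transcript hS x, fun w hw => C.eq_transcript_of_consistent hS x w hw⟩

/-- The output node of the semicircuit has the value of the circuit. [folklore] -/
theorem nodeVal_out_toSemicircuit (x : Fin n → Bool) :
    (C.toSemicircuit hS).nodeVal x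
        (fun k : Fin C.gates.length => (transcript x [] C.gates).getD (k : ℕ) false)
        (C.toSemicircuit hS).out = C.eval x := by
  rw [eval_eq_wireVal]
  exact C.nodeVal_eq_wireVal hS x _ _ (fun k => rfl) C.outNode _ C.nodeWire_outNode

/-- **A circuit computing `f` computes `f|_∅`.** [cite: LiYang2022, §2.3] -/
theorem computesRestr_toSemicircuit_free {f : (Fin n → ZMod 2) → Bool}
    (hC : C.Computes (f ∘ Literature.Computability.Complexity.boolOfZMod2)) :
    (C.toSemicircuit hS).ComputesRestr f (RdqSource.free n) := by
  refine ⟨fun j hj => absurd ⟨rfl, rfl⟩ hj, fun v _ w hw => ?_⟩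
  rw [C.eq_transcript_of_consistent hS _ w hw, nodeVal_out_toSemicircuit, hC]
  simp

/-- The empty packing. [cite: LiYang2022, Def. 3.3] -/
theorem _root_.Literature.Computability.Complexity.Semicircuit.isPacking_empty {n : ℕ} (S : Semicircuit n) :
    S.IsPacking ∅ :=
  ⟨fun p hp => absurd hp (Finset.notMem_empty p), fun p hp => absurd hp (Finset.notMem_empty p)⟩

end ToSemicircuit

end Circuit

namespace RdqSource

/-- The empty source has dimension `n`. [cite: LiYang2022, Def. 2.2] -/
@[simp] theorem dim_free (n : ℕ) : (RdqSource.free n).dim = n := by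
  unfold dim
  rw [Finset.filter_true_of_mem fun j _ => ⟨rfl, rfl⟩, Finset.card_univ, Fintype.card_fin]

/-- The empty source has no quadratic equations. [cite: LiYang2022, Def. 2.2] -/
@[simp] theorem quadCount_free (n : ℕ) : (RdqSource.free n).quadCount = 0 := by
  unfold quadCount
  simp [RdqSource.free]

/-- The empty source is all of `𝔽₂ⁿ`. [cite: LiYang2022, Def. 2.2] -/
@[simp] theorem sol_free (n : ℕ) : (RdqSource.free n).Sol = Set.univ := by
  ext v
  simp [Sol, RdqSource.free]

end RdqSource

end Literature.Computability.Complexity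

namespace Literature.Computability.Complexity

open Finset

/-- The parameters of the proof of Thm. 1.1 give `δ = 12.8`
(`min{3.2, 3.4, 3.2, 3.2, 3.2, 3.2} = 3.2`). [cite: LiYang2022, proof of Thm. 1.1 (§4)] -/
theorem liYangDelta_opt : liYangDelta 0.2 9.6 1.8 = 12.8 := by
  norm_num [liYangDelta, min_def]

/-- **Theorem 4.1 (as vendored) from the one-step claim**: `LiYang2022_step` implies
`LiYang2022_measure_ge`, i.e. `12.8 (n - 2d - 2) ≤ g + 9.6 · i + 0.2 · t` for every simple
binary circuit computing an affine disperser for dimension `d` — `measure_ge_of_step` for the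
semicircuit `C.toSemicircuit` with the empty packing and the empty rdq-source at
`(α_φ, α_I, α_Q) = (0.2, 9.6, 1.8)`. [cite: LiYang2022, Thm. 4.1] -/
theorem LiYang2022_measure_ge_of_step (h : LiYang2022_step) : LiYang2022_measure_ge := by
  intro n d f hf C hS hC
  have key := measure_ge_of_step h (αφ := 0.2) (αI := 9.6) (αQ := 1.8) (by norm_num)
    (by norm_num) (by norm_num) (by norm_num) (by rw [liYangDelta_opt]; norm_num) hf
    (C.toSemicircuit hS) (RdqSource.free n) ∅ (C.fair_toSemicircuit hS)
    (C.computesRestr_toSemicircuit_free hS hC) (Semicircuit.isPacking_empty _)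
  rw [liYangDelta_opt, RdqSource.dim_free] at key
  unfold Semicircuit.measure Semicircuit.potential at key
  rw [C.card_influential_toSemicircuit_free hS, RdqSource.quadCount_free,
    C.troubledCount_toSemicircuit hS, Finset.card_empty, Circuit.toSemicircuit_m] at key
  unfold Circuit.size
  push_cast at key
  linarith

/-- **Li–Yang's Theorem 1.1 from the one-step claim**: `LiYang2022_step → li_yang`
(via `LiYang2022_measure_ge_of_step`, Lemma 3.7 and Thm. 3.9 proved in `GateElimination.lean`,
and `LiYang2022_size_ge.li_yang`). [cite: LiYang2022, Thm. 1.1] -/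
theorem li_yang_of_step (h : LiYang2022_step) : li_yang :=
  li_yang_of_measure_ge (LiYang2022_measure_ge_of_step h)

end Literature.Computability.Complexity
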